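import Mathlib
import Summits.Ventures.DiscreteObjects.Mahler.SmallMeasureCensus

/-!
# Gonçalves' inequality (venture `DiscreteObjects`, target L)

Cell `pub-namedobj`, seat `pub-namedobj-mahler` (gen 10). Framing: lottery ticket; floor = certified
bounds/negative ranges.

[McKee–Smyth, *Around the Unit Circle*, Prop. 1.12 (Gonçalves' Inequality) and Exercise 1.15 (complex
coefficients)]: for `P(z) = a_d z^d + ⋯ + a_0 ∈ ℂ[z]` with `d ≥ 1` and `a_0 a_d ≠ 0`,
`M(P)² + |a_0 a_d|² / M(P)² ≤ ∑ |a_j|²`.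
This sharpens Landau's (Specht's) inequality `M(P) ≤ √(∑ |a_j|²)` (Mathlib
`mahlerMeasure_le_sqrt_sum_sq_norm_coeff`), and gives the explicit bound
`M(P)² ≤ (N + √(N² - 4|a_0 a_d|²))/2`, `N = ∑ |a_j|²` — for the census (target L): a monic integer
polynomial with `P(0) = ±1` and `N` nonzero coefficients of absolute value `1` has `M(P)² ≤ (N + √(N²-4))/2`.

Kernel route (algebraic form of the book's proof).  Replacing a factor `z - α` of `P` by `ᾱ z - 1`
does not change `|P|` on the unit circle, hence (Parseval, Mathlib `sum_sq_norm_coeff_eq_circleAverage`)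
does not change `∑ |a_j|²` (`sum_sq_norm_coeff_flip`).  Flipping every root inside the unit disc turns
`P = a ∏ (z - α)` into `R = a ∏_{|α|≥1} (z - α) ∏_{|α|<1} (ᾱ z - 1)` with `|R(0)| = |a| ∏_{|α|≥1} |α| = M(P)`
and `|lc(R)| = |a| ∏_{|α|<1} |α| = |a a_0| / M(P)`, and `∑|a_j|² = ∑ |R_j|² ≥ |R(0)|² + |lc(R)|²`.

* `sum_sq_norm_coeff_flip`, `sum_sq_norm_coeff_multiflip` — flipping roots preserves `∑ |a_j|²`;
* `goncalves_inequality` — complex form; `goncalves_inequality_int` — for `P ∈ ℤ[X]`;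
* `mahlerMeasure_sq_le_goncalves` — `M(P)² ≤ (N + √(N² - 4|a_0 a_d|²))/2`.
-/

namespace Summit.Ventures.DiscreteObjects.Mahler

open Polynomial
open scoped ComplexConjugate

/-! ### Flipping a root across the unit circle -/

/-- On the unit circle, `|ᾱ z - 1| = |z - α|`. -/
theorem norm_conj_mul_sub_one_of_norm_eq_one {z : ℂ} (hz : ‖z‖ = 1) (α : ℂ) :
    ‖conj α * z - 1‖ = ‖z - α‖ := by
  have h1 : conj z * z = 1 := by
    rw [mul_comm, Complex.mul_conj, Complex.normSq_eq_norm_sq, hz]; norm_num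
  have h2 : conj α * z - 1 = conj (α * conj z - 1) := by
    simp [map_sub, map_mul]
  have h3 : α * conj z - 1 = conj z * (α - z) := by linear_combination h1
  rw [h2, Complex.norm_conj, h3, norm_mul, Complex.norm_conj, hz, one_mul, norm_sub_rev]

/-- The flipped linear factor `ᾱ X - 1`, written as `C ᾱ * X + C (-1)`. -/
theorem eval_flip (α z : ℂ) : (C (conj α) * X + C (-1) : ℂ[X]).eval z = conj α * z - 1 := by
  simp [sub_eq_add_neg]

/-- **Flip lemma.** Replacing the factor `X - α` by `ᾱ X - 1` preserves `∑ |coeff|²`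
(Parseval + `|ᾱ z - 1| = |z - α|` on the unit circle). -/
theorem sum_sq_norm_coeff_flip (S : ℂ[X]) (α : ℂ) :
    ∑ i ∈ ((X - C α) * S).support, ‖((X - C α) * S).coeff i‖ ^ 2 =
      ∑ i ∈ ((C (conj α) * X + C (-1)) * S).support, ‖((C (conj α) * X + C (-1)) * S).coeff i‖ ^ 2 := by
  rw [sum_sq_norm_coeff_eq_circleAverage, sum_sq_norm_coeff_eq_circleAverage]
  apply Real.circleAverage_congr_sphere
  intro z hz
  rw [abs_one, mem_sphere_zero_iff_norm] at hz
  simp only [eval_mul, norm_mul, eval_sub, eval_X, eval_C, eval_flip]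
  rw [norm_conj_mul_sub_one_of_norm_eq_one hz α]

/-- **Multi-flip.** Flipping every root of a multiset `I` preserves `∑ |coeff|²`. -/
theorem sum_sq_norm_coeff_multiflip (I : Multiset ℂ) :
    ∀ G : ℂ[X], ∑ i ∈ ((I.map fun α => X - C α).prod * G).support,
        ‖((I.map fun α => X - C α).prod * G).coeff i‖ ^ 2 =
      ∑ i ∈ ((I.map fun α => C (conj α) * X + C (-1)).prod * G).support,
        ‖((I.map fun α => C (conj α) * X + C (-1)).prod * G).coeff i‖ ^ 2 := by
  induction I using Multiset.induction_on with
  | empty => intro G; simp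
  | cons α I ih =>
    intro G
    rw [Multiset.map_cons, Multiset.prod_cons, Multiset.map_cons, Multiset.prod_cons, mul_assoc,
      sum_sq_norm_coeff_flip, mul_left_comm, ih ((C (conj α) * X + C (-1)) * G), mul_left_comm, mul_assoc]

/-! ### Gonçalves' inequality -/

/-- `‖∏ s‖ = ∏ ‖·‖` over a multiset of complex numbers (local helper). -/
private theorem norm_multiset_prod_norms (s : Multiset ℂ) : ‖s.prod‖ = (s.map fun α => ‖α‖).prod := by
  rw [← normHom_apply, map_multiset_prod]; rfl

/-- `∑_{support} |coeff|² ≥ |coeff 0|² + |lc|²` for a polynomial of positive degree. -/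
theorem sq_coeff_zero_add_sq_leadingCoeff_le (R : ℂ[X]) (hR : 0 < R.natDegree) :
    ‖R.coeff 0‖ ^ 2 + ‖R.leadingCoeff‖ ^ 2 ≤ ∑ i ∈ R.support, ‖R.coeff i‖ ^ 2 := by
  classical
  have hR0 : R ≠ 0 := by rintro rfl; simp at hR
  by_cases hc0 : R.coeff 0 = 0
  · rw [hc0, norm_zero, zero_pow two_ne_zero, zero_add]
    have hmem : R.natDegree ∈ R.support := natDegree_mem_support_of_nonzero hR0
    exact Finset.single_le_sum (f := fun i => ‖R.coeff i‖ ^ 2) (fun i _ => sq_nonneg _) hmem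
  · have hsub : ({0, R.natDegree} : Finset ℕ) ⊆ R.support := by
      intro i hi
      rw [Finset.mem_insert, Finset.mem_singleton] at hi
      rcases hi with rfl | rfl
      · exact mem_support_iff.mpr hc0
      · exact natDegree_mem_support_of_nonzero hR0
    have h := Finset.sum_le_sum_of_subset_of_nonneg hsub (f := fun i => ‖R.coeff i‖ ^ 2)
      (fun i _ _ => sq_nonneg _)
    rwa [Finset.sum_pair (Nat.pos_iff_ne_zero.mp hR).symm] at h

/-- **Gonçalves' inequality** ([McKee–Smyth, Prop. 1.12; Exercise 1.15] for complex coefficients):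
for `P ∈ ℂ[X]` of degree `d ≥ 1` with `P(0) ≠ 0`,
`M(P)² + (|P(0)|·|lc(P)| / M(P))² ≤ ∑_j |a_j|²`. -/
theorem goncalves_inequality (P : ℂ[X]) (hdeg : 0 < P.natDegree) (h0 : P.coeff 0 ≠ 0) :
    P.mahlerMeasure ^ 2 + (‖P.coeff 0‖ * ‖P.leadingCoeff‖ / P.mahlerMeasure) ^ 2 ≤
      ∑ i ∈ P.support, ‖P.coeff i‖ ^ 2 := by
  classical
  have hP : P ≠ 0 := by rintro rfl; simp at hdeg
  set a := P.leadingCoeff with ha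
  have ha0 : a ≠ 0 := leadingCoeff_ne_zero.mpr hP
  set R₀ := P.roots with hR₀
  have hsplit : P = C a * (R₀.map fun α => X - C α).prod := (IsAlgClosed.splits P).eq_prod_roots
  -- roots are nonzero
  have hroot0 : ∀ α ∈ R₀, α ≠ 0 := by
    intro α hα h
    rw [h, hR₀, mem_roots hP, IsRoot.def, ← coeff_zero_eq_eval_zero] at hα
    exact h0 hα
  -- split the roots: inside the open unit disc / the rest
  set inn := R₀.filter fun α => ‖α‖ < 1 with hinn
  set out := R₀.filter fun α => ¬ ‖α‖ < 1 with hout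
  have hsplit₀ : inn + out = R₀ := Multiset.filter_add_not _ R₀
  set G : ℂ[X] := C a * (out.map fun α => X - C α).prod with hG
  have hPG : P = (inn.map fun α => X - C α).prod * G := by
    rw [hG, hsplit, ← hsplit₀, Multiset.map_add, Multiset.prod_add]; ring
  set Rf : ℂ[X] := (inn.map fun α => C (conj α) * X + C (-1)).prod * G with hRf
  have hN : ∑ i ∈ P.support, ‖P.coeff i‖ ^ 2 = ∑ i ∈ Rf.support, ‖Rf.coeff i‖ ^ 2 := by
    rw [hPG, hRf]; exact sum_sq_norm_coeff_multiflip inn G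
  -- leading coefficient of `Rf`
  have hlin : ∀ α ∈ inn, (C (conj α) * X + C (-1) : ℂ[X]).leadingCoeff = conj α := by
    intro α hα
    have hα0 : conj α ≠ 0 := by
      rw [map_ne_zero_iff _ (RingHom.injective _)]
      exact hroot0 α (Multiset.mem_of_mem_filter hα)
    exact leadingCoeff_linear hα0
  have hleadRf : Rf.leadingCoeff = (inn.map fun α => conj α).prod * a := by
    rw [hRf, leadingCoeff_mul, leadingCoeff_multiset_prod, Multiset.map_map, hG, leadingCoeff_mul,
      leadingCoeff_C, leadingCoeff_multiset_prod, Multiset.map_map]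
    have h1 : (out.map (Polynomial.leadingCoeff ∘ fun α => X - C α)) = out.map fun _ => (1 : ℂ) :=
      Multiset.map_congr rfl fun α _ => by simp [leadingCoeff_X_sub_C]
    have h2 : (inn.map (Polynomial.leadingCoeff ∘ fun α => C (conj α) * X + C (-1))) =
        inn.map fun α => conj α := Multiset.map_congr rfl fun α hα => hlin α hα
    rw [h1, h2, Multiset.map_const', Multiset.prod_replicate, one_pow, mul_one]
  -- constant coefficient of `Rf`
  have hc0Rf : Rf.coeff 0 = (inn.map fun _ => (-1 : ℂ)).prod * (a * (out.map fun α => -α).prod) := by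
    rw [hRf, mul_coeff_zero, coeff_zero_multiset_prod, Multiset.map_map, hG, mul_coeff_zero, coeff_C_zero,
      coeff_zero_multiset_prod, Multiset.map_map]
    congr 1
    · exact congrArg _ (Multiset.map_congr rfl fun α _ => by simp)
    · congr 1
      exact congrArg _ (Multiset.map_congr rfl fun α _ => by simp)
  -- norms
  have hnormRf0 : ‖Rf.coeff 0‖ = ‖a‖ * (out.map fun α => ‖α‖).prod := by
    rw [hc0Rf, norm_mul, norm_mul]
    have h1 : ‖(inn.map fun _ => (-1 : ℂ)).prod‖ = 1 := by
      rw [Multiset.map_const', Multiset.prod_replicate, norm_pow, norm_neg, norm_one, one_pow]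
    have h2 : ‖(out.map fun α => -α).prod‖ = (out.map fun α => ‖α‖).prod := by
      rw [norm_multiset_prod_norms, Multiset.map_map]
      exact congrArg _ (Multiset.map_congr rfl fun α _ => by simp)
    rw [h1, h2, one_mul]
  have hnormlead : ‖Rf.leadingCoeff‖ = (inn.map fun α => ‖α‖).prod * ‖a‖ := by
    rw [hleadRf, norm_mul, norm_multiset_prod_norms, Multiset.map_map]
    congr 1
    exact congrArg _ (Multiset.map_congr rfl fun α _ => by simp)
  -- `M(P) = |a| ∏_{out} |α|`
  have hM : P.mahlerMeasure = ‖a‖ * (out.map fun α => ‖α‖).prod := by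
    rw [mahlerMeasure_eq_leadingCoeff_mul_prod_roots, ← ha, ← hR₀, ← hsplit₀, Multiset.map_add,
      Multiset.prod_add]
    have h1 : (inn.map fun α => max 1 ‖α‖) = inn.map fun _ => (1 : ℝ) :=
      Multiset.map_congr rfl fun α hα => max_eq_left (le_of_lt (Multiset.mem_filter.mp hα).2)
    have h2 : (out.map fun α => max 1 ‖α‖) = out.map fun α => ‖α‖ :=
      Multiset.map_congr rfl fun α hα => max_eq_right (not_lt.mp (Multiset.mem_filter.mp hα).2)
    rw [h1, h2, Multiset.map_const', Multiset.prod_replicate, one_pow, one_mul]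
  -- `|P(0)| = |a| ∏_{all} |α| = M(P) · ∏_{inn} |α|`
  have hP0 : ‖P.coeff 0‖ = P.mahlerMeasure * (inn.map fun α => ‖α‖).prod := by
    have h1 : P.coeff 0 = a * (R₀.map fun α => -α).prod := by
      conv_lhs => rw [hsplit]
      rw [mul_coeff_zero, coeff_C_zero, coeff_zero_multiset_prod, Multiset.map_map]
      congr 1
      exact congrArg _ (Multiset.map_congr rfl fun α _ => by simp)
    rw [h1, norm_mul, norm_multiset_prod_norms, Multiset.map_map, hM, ← hsplit₀]
    have h2 : (inn + out).map ((fun α : ℂ => ‖α‖) ∘ fun α : ℂ => -α) = (inn + out).map fun α => ‖α‖ :=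
      Multiset.map_congr rfl fun α _ => by simp
    rw [h2, Multiset.map_add, Multiset.prod_add]
    ring
  have hMpos : 0 < P.mahlerMeasure := mahlerMeasure_pos_of_ne_zero hP
  -- degree of `Rf` is positive: it has a root
  have hRf0 : Rf ≠ 0 := by
    intro h
    have := congrArg (fun p : ℂ[X] => ∑ i ∈ p.support, ‖p.coeff i‖ ^ 2) h
    simp only [support_zero, Finset.sum_empty] at this
    rw [← hN] at this
    have hmem : P.natDegree ∈ P.support := natDegree_mem_support_of_nonzero hP
    have hle := Finset.single_le_sum (f := fun i => ‖P.coeff i‖ ^ 2) (fun i _ => sq_nonneg _) hmem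
    rw [this] at hle
    have : ‖P.leadingCoeff‖ ^ 2 ≤ 0 := hle
    exact ha0 (norm_eq_zero.mp (by nlinarith [norm_nonneg P.leadingCoeff]))
  have hRfdeg : 0 < Rf.natDegree := by
    -- pick a root of `P`; its flipped or unflipped linear factor divides `Rf`
    have hcard : 0 < Multiset.card R₀ := by
      rw [hR₀, splits_iff_card_roots.mp (IsAlgClosed.splits P)]; exact hdeg
    obtain ⟨α, hα⟩ := Multiset.card_pos_iff_exists_mem.mp hcard
    rw [← hsplit₀, Multiset.mem_add] at hα
    apply natDegree_pos_iff_degree_pos.mpr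
    rcases hα with hα | hα
    · have hα0 : conj α ≠ 0 := by
        rw [map_ne_zero_iff _ (RingHom.injective _)]
        exact hroot0 α (Multiset.mem_of_mem_filter hα)
      refine degree_pos_of_root hRf0 (a := (conj α)⁻¹) ?_
      have hdvd : (C (conj α) * X + C (-1) : ℂ[X]) ∣ Rf := by
        rw [hRf]; exact (Multiset.dvd_prod (Multiset.mem_map_of_mem _ hα)).mul_right _
      obtain ⟨T, hT⟩ := hdvd
      rw [IsRoot.def, hT, eval_mul, eval_flip, mul_inv_cancel₀ hα0, sub_self, zero_mul]
    · refine degree_pos_of_root hRf0 (a := α) ?_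
      have hdvd : (X - C α : ℂ[X]) ∣ Rf := by
        rw [hRf, hG]
        exact ((Multiset.dvd_prod (Multiset.mem_map_of_mem _ hα)).mul_left _).mul_left _
      obtain ⟨T, hT⟩ := hdvd
      rw [IsRoot.def, hT, eval_mul, eval_sub, eval_X, eval_C, sub_self, zero_mul]
  -- assemble
  have hkey := sq_coeff_zero_add_sq_leadingCoeff_le Rf hRfdeg
  rw [← hN, hnormRf0, ← hM, hnormlead] at hkey
  have hlead_eq : (inn.map fun α => ‖α‖).prod * ‖a‖ = ‖P.coeff 0‖ * ‖P.leadingCoeff‖ / P.mahlerMeasure := by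
    rw [hP0, ← ha]
    field_simp
  rw [hlead_eq] at hkey
  exact hkey

/-- **Gonçalves' bound solved for `M(P)²`:** with `N = ∑ |a_j|²` and `c = |a_0 a_d|`,
`M(P)² ≤ (N + √(N² - 4c²)) / 2`. -/
theorem mahlerMeasure_sq_le_goncalves (P : ℂ[X]) (hdeg : 0 < P.natDegree) (h0 : P.coeff 0 ≠ 0) :
    P.mahlerMeasure ^ 2 ≤ ((∑ i ∈ P.support, ‖P.coeff i‖ ^ 2) +
      Real.sqrt ((∑ i ∈ P.support, ‖P.coeff i‖ ^ 2) ^ 2 -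
        4 * (‖P.coeff 0‖ * ‖P.leadingCoeff‖) ^ 2)) / 2 := by
  have hP : P ≠ 0 := by rintro rfl; simp at hdeg
  have hMpos : 0 < P.mahlerMeasure := mahlerMeasure_pos_of_ne_zero hP
  have h := goncalves_inequality P hdeg h0
  set N := ∑ i ∈ P.support, ‖P.coeff i‖ ^ 2 with hNdef
  set c := ‖P.coeff 0‖ * ‖P.leadingCoeff‖ with hc
  set m := P.mahlerMeasure ^ 2 with hm
  have hm0 : 0 < m := by positivity
  -- `m + c²/m ≤ N` ⇒ `m² - N m + c² ≤ 0` ⇒ `(2m - N)² ≤ N² - 4c²`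
  have h1 : m + c ^ 2 / m ≤ N := by
    have : (c / P.mahlerMeasure) ^ 2 = c ^ 2 / m := by rw [hm, div_pow]
    linarith [h, this]
  have h2 : m * m + c ^ 2 ≤ N * m := by
    have := mul_le_mul_of_nonneg_right h1 hm0.le
    rwa [add_mul, div_mul_cancel₀ _ hm0.ne'] at this
  have h3 : (2 * m - N) ^ 2 ≤ N ^ 2 - 4 * c ^ 2 := by nlinarith
  have h4 : 2 * m - N ≤ Real.sqrt (N ^ 2 - 4 * c ^ 2) := by
    calc 2 * m - N ≤ |2 * m - N| := le_abs_self _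
      _ = Real.sqrt ((2 * m - N) ^ 2) := (Real.sqrt_sq_eq_abs _).symm
      _ ≤ Real.sqrt (N ^ 2 - 4 * c ^ 2) := Real.sqrt_le_sqrt h3
  linarith

/-- **Gonçalves' inequality for integer polynomials:** for `P ∈ ℤ[X]` of degree `≥ 1` with `P(0) ≠ 0`,
`M(P)² + (P(0)·lc(P) / M(P))² ≤ ∑_j a_j²`. -/
theorem goncalves_inequality_int (P : ℤ[X]) (hdeg : 0 < P.natDegree) (h0 : P.coeff 0 ≠ 0) :
    intMahlerMeasure P ^ 2 + ((P.coeff 0 : ℝ) * P.leadingCoeff / intMahlerMeasure P) ^ 2 ≤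
      ∑ i ∈ P.support, ((P.coeff i : ℝ)) ^ 2 := by
  have hinj := (Int.castRingHom ℂ).injective_int
  have h := goncalves_inequality (P.map (Int.castRingHom ℂ))
    (by rwa [natDegree_map_eq_of_injective hinj]) (by rw [coeff_map, eq_intCast]; exact_mod_cast h0)
  unfold intMahlerMeasure
  rw [support_map_of_injective P hinj, leadingCoeff_map_of_injective hinj] at h
  simp only [coeff_map, eq_intCast, Complex.norm_intCast] at h
  have h1 : ∑ x ∈ P.support, |((P.coeff x : ℤ) : ℝ)| ^ 2 = ∑ i ∈ P.support, ((P.coeff i : ℝ)) ^ 2 :=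
    Finset.sum_congr rfl fun i _ => sq_abs _
  have h2 : (|((P.coeff 0 : ℤ) : ℝ)| * |((P.leadingCoeff : ℤ) : ℝ)| /
      (P.map (Int.castRingHom ℂ)).mahlerMeasure) ^ 2 =
      (((P.coeff 0 : ℤ) : ℝ) * P.leadingCoeff / (P.map (Int.castRingHom ℂ)).mahlerMeasure) ^ 2 := by
    rw [← abs_mul, div_pow, div_pow, sq_abs]
  rw [h1, h2] at h
  exact h

end Summit.Ventures.DiscreteObjects.Mahler
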